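import Literature.NumberTheory.LFunctions.ResidueClassRieszMeanLogFree
import Literature.NumberTheory.LFunctions.SegmentWeights
import HarnessLib

/-!
# Mean squares of `F_{q,a}` on the line `Re s = σ₁ + ε` (segment by segment), and the multipliers
# of multiplicative averaging and shifting

Topic `Literature/NumberTheory/LFunctions`. Everything in this file is PROVED (theorems only).

With the local partial fraction on the segments `S_n` (`Literature.NumberTheory.LFunctions.ResidueRiesz.Cpkg_spec`)
one has `|F_{q,a}(s)|² ≤ 2(Cφℒ_n)² + 2 (∑|w|)(∑ |w_ρ|/|s − ρ|²)` on `S_n` (Cauchy–Schwarz), and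
`∫_{S_n} dt/|s − ρ|² ≤ π/ε` since every `ρ` has `Re ρ ≤ σ₁ = σ' − ε`; hence
`∫_{S_n} |F_{q,a}(σ' + it)|² dt ≤ (Cφℒ_n)²(2π + 1)/ε` (`setIntegral_seg_norm_sq_Faux_le`), and for a
weight `w ≤ W_n` on `S_n`, `∫_ℝ |F_{q,a}|² w ≤ (Cφ)²(2π+1)ε⁻¹ ∑_n ℒ_n² W_n`
(`integral_norm_sq_Faux_mul_le`). The two weights needed for the mean squares of the remainder
`ψ(u; Λ_{q,a}) − u` and of its multiplicative differences are `w = 1/|s|²` (sum `≪ (log q + 1)²`,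
`integral_norm_sq_Faux_div_le`) and `w = min(1/|s|², θ²)` (sum `≪ (log q+1)² θ (1 + log(1/θ))²`,
`integral_norm_sq_Faux_min_le`), the sums being those of `SegmentWeights.lean`. Finally the
multipliers `m_h(s) = (e^{h(1+s)} − 1)/(e^h − 1)` (`‖m_h(s)‖ ≤ 9‖s + 1‖` for `0 < h ≤ 1`,
`0 ≤ Re s ≤ 1`) and `e^{θs} − 1` (`≤ 4 min(1, θ‖s‖)` for `0 < θ ≤ 1`) are estimated.

## References

* H. L. Montgomery, R. C. Vaughan, *Multiplicative Number Theory I. Classical Theory*, CUP 2007,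
  §5.1 Thm. 5.4, Lemma 12.6, §13.1 (`MontgomeryVaughan2007`).
-/

noncomputable section

open Complex Set Metric Filter Topology Real MeasureTheory intervalIntegral
open ArithmeticFunction.vonMangoldt DirichletCharacter

namespace Literature.NumberTheory.LFunctions.ResidueRiesz

/-! ### The multipliers -/

/-- The averaging multiplier `m_h(s) = (e^{h(1+s)} − 1)/(e^h − 1)`. [folklore] -/
def mh (h : ℝ) (s : ℂ) : ℂ := (cexp (h * (1 + s)) - 1) / ((Real.exp h - 1 : ℝ) : ℂ)

/-- **`‖m_h(s)‖ ≤ 9 ‖s + 1‖`** for `0 < h ≤ 1` and `0 ≤ Re s ≤ 1`. [folklore] -/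
theorem norm_mh_le {h : ℝ} (hh : 0 < h) (hh1 : h ≤ 1) {s : ℂ} (hs0 : 0 ≤ s.re) (hs1 : s.re ≤ 1) :
    ‖mh h s‖ ≤ 9 * ‖s + 1‖ := by
  have hexp : h ≤ Real.exp h - 1 := by linarith [Real.add_one_le_exp h]
  have hden : 0 < Real.exp h - 1 := lt_of_lt_of_le hh hexp
  set z : ℂ := (h : ℂ) * (1 + s) with hz
  have hzn : ‖z‖ = h * ‖s + 1‖ := by
    rw [hz, norm_mul, Complex.norm_real, Real.norm_of_nonneg hh.le, add_comm]
  have hs1pos : 0 < ‖s + 1‖ := by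
    have : (1 : ℝ) ≤ (s + 1).re := by simp; linarith
    exact lt_of_lt_of_le zero_lt_one (this.trans (re_le_norm _))
  rw [mh, norm_div, Complex.norm_real, Real.norm_of_nonneg hden.le, div_le_iff₀ hden]
  rcases le_or_gt ‖z‖ 1 with hz1 | hz1
  · -- `‖e^z − 1‖ ≤ 2‖z‖ = 2h‖s+1‖ ≤ 2 (e^h − 1) ‖s + 1‖`
    have h1 : ‖cexp z - 1‖ ≤ 2 * ‖z‖ := Complex.norm_exp_sub_one_le hz1
    rw [hzn] at h1
    calc ‖cexp ((h : ℂ) * (1 + s)) - 1‖ = ‖cexp z - 1‖ := by rw [hz]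
      _ ≤ 2 * (h * ‖s + 1‖) := h1
      _ ≤ 2 * ((Real.exp h - 1) * ‖s + 1‖) := by gcongr
      _ ≤ 9 * ‖s + 1‖ * (Real.exp h - 1) := by nlinarith [mul_pos hden hs1pos]
  · -- `‖e^z − 1‖ ≤ e² + 1 ≤ 9` and `1 ≤ h ‖s+1‖ ≤ (e^h − 1)‖s + 1‖`
    have exp_two_le_eight : Real.exp 2 ≤ 8 := by
      have h := Real.exp_one_lt_d9
      have : Real.exp 2 = Real.exp 1 * Real.exp 1 := by rw [← Real.exp_add]; norm_num
      rw [this]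
      nlinarith [Real.exp_pos 1]
    have h2 : ‖cexp z - 1‖ ≤ 9 := by
      have hre : z.re ≤ 2 := by
        rw [hz]
        simp only [mul_re, ofReal_re, add_re, one_re, ofReal_im, zero_mul, sub_zero, add_im, one_im,
          zero_add]
        nlinarith
      calc ‖cexp z - 1‖ ≤ ‖cexp z‖ + ‖(1 : ℂ)‖ := norm_sub_le _ _
        _ = Real.exp z.re + 1 := by rw [Complex.norm_exp, norm_one]
        _ ≤ Real.exp 2 + 1 := by gcongr
        _ ≤ 9 := by linarith [exp_two_le_eight]
    have h3 : 1 ≤ (Real.exp h - 1) * ‖s + 1‖ := by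
      rw [hzn] at hz1
      nlinarith [mul_le_mul_of_nonneg_right hexp hs1pos.le]
    calc ‖cexp ((h : ℂ) * (1 + s)) - 1‖ = ‖cexp z - 1‖ := by rw [hz]
      _ ≤ 9 * 1 := by linarith
      _ ≤ 9 * ((Real.exp h - 1) * ‖s + 1‖) := by gcongr
      _ = 9 * ‖s + 1‖ * (Real.exp h - 1) := by ring

/-- **`‖e^{θs} − 1‖ ≤ 4 min(1, θ‖s‖)`** for `0 < θ ≤ 1` and `0 ≤ Re s ≤ 1`. [folklore] -/
theorem norm_cexp_sub_one_le_min {θ : ℝ} (hθ : 0 < θ) (hθ1 : θ ≤ 1) {s : ℂ}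
    (hs1 : s.re ≤ 1) : ‖cexp (θ * s) - 1‖ ≤ 4 * min 1 (θ * ‖s‖) := by
  set z : ℂ := (θ : ℂ) * s with hz
  have hzn : ‖z‖ = θ * ‖s‖ := by rw [hz, norm_mul, Complex.norm_real, Real.norm_of_nonneg hθ.le]
  rcases le_or_gt (θ * ‖s‖) 1 with h1 | h1
  · rw [min_eq_right h1]
    have := Complex.norm_exp_sub_one_le (x := z) (by rwa [hzn])
    rw [hzn] at this
    have h0 : 0 ≤ θ * ‖s‖ := by positivity
    calc ‖cexp ((θ : ℂ) * s) - 1‖ = ‖cexp z - 1‖ := by rw [hz]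
      _ ≤ 2 * (θ * ‖s‖) := this
      _ ≤ 4 * (θ * ‖s‖) := by nlinarith
  · rw [min_eq_left h1.le]
    have hre : z.re ≤ 1 := by
      rw [hz]
      simp only [mul_re, ofReal_re, ofReal_im, zero_mul, sub_zero]
      nlinarith
    calc ‖cexp ((θ : ℂ) * s) - 1‖ = ‖cexp z - 1‖ := by rw [hz]
      _ ≤ ‖cexp z‖ + ‖(1 : ℂ)‖ := norm_sub_le _ _
      _ = Real.exp z.re + 1 := by rw [Complex.norm_exp, norm_one]
      _ ≤ Real.exp 1 + 1 := by gcongr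
      _ ≤ 4 * 1 := by linarith [Real.exp_one_lt_d9]

/-! ### The mean square of `F_{q,a}` on one segment -/

variable {q : ℕ} [NeZero q]

/-- `∫_{S_n} dt/‖σ' + it − ρ‖² ≤ π/(σ' − Re ρ)` for `Re ρ < σ'`. [folklore] -/
theorem setIntegral_seg_inv_norm_sq_le {σ' : ℝ} {ρ : ℂ} (hρ : ρ.re < σ') (n : ℤ) :
    ∫ t in seg n, (‖(σ' : ℂ) + t * I - ρ‖ ^ 2)⁻¹ ≤ π / (σ' - ρ.re) := by
  have hα : 0 < σ' - ρ.re := by linarith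
  have heq : ∀ t : ℝ, (‖(σ' : ℂ) + t * I - ρ‖ ^ 2)⁻¹ = 1 / ((σ' - ρ.re) ^ 2 + (t - ρ.im) ^ 2) := by
    intro t
    have : (σ' : ℂ) + t * I - ρ = ((σ' - ρ.re : ℝ) : ℂ) + ((t - ρ.im : ℝ) : ℂ) * I := by
      conv_lhs => rw [← re_add_im ρ]
      push_cast; ring
    rw [this, Complex.sq_norm, Complex.normSq_add_mul_I, one_div]
  set T : ℝ := (n : ℝ) / 10 with hT
  rw [setIntegral_congr_fun (measurableSet_seg n) (fun t _ ↦ heq t), seg, integral_Ico_eq_integral_Ioo,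
    ← integral_Ioc_eq_integral_Ioo, ← intervalIntegral.integral_of_le (by linarith)]
  exact integral_inv_sq_add_sq_le hα ρ.im _ _

/-- **The mean square on a segment.** Under `ZerosRealPartLE q σ₁` (`σ₁ ≥ 1/2`), for `0 < ε`,
`σ₁ + ε < 1`, and every `n ∈ ℤ`:
`∫_{S_n} |F_{q,a}(σ₁ + ε + it)|² dt ≤ (C φ(q) ℒ_n)² (2π + 1)/ε`, `ℒ_n = log q + log(|n/10| + 4)`.
[cite: MontgomeryVaughan2007, Lemma 12.6 (consequence)] -/
theorem setIntegral_seg_norm_sq_Faux_le (a : ZMod q) {σ₁ : ℝ} (hσ₁ : 1 / 2 ≤ σ₁)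
    (hZ : ZerosRealPartLE q σ₁) {ε : ℝ} (hε : 0 < ε) (hσ'1 : σ₁ + ε < 1) (n : ℤ) :
    IntegrableOn (fun t : ℝ ↦ ‖Faux a ((σ₁ + ε : ℝ) + t * I)‖ ^ 2) (seg n) ∧
    ∫ t in seg n, ‖Faux a ((σ₁ + ε : ℝ) + t * I)‖ ^ 2 ≤
      (Cpkg * q.totient * (Real.log q + Real.log (|(n : ℝ) / 10| + 4))) ^ 2 * ((2 * π + 1) / ε) := by
  set σ' : ℝ := σ₁ + ε with hσ'
  have hσ'σ₁ : σ₁ < σ' := by rw [hσ']; linarith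
  have hσ'half : 1 / 2 ≤ σ' := by linarith
  have hσ'2 : σ' ≤ 2 := by linarith
  have hε1 : ε ≤ 1 / 2 := by linarith
  set T : ℝ := (n : ℝ) / 10 with hT
  set ℒ : ℝ := Real.log q + Real.log (|T| + 4) with hℒ
  have hℒ0 : 0 ≤ ℒ := by linarith [DirichletZFR.one_le_ell q T]
  have hC0 := Cpkg_pos
  have hφ0 : (0 : ℝ) ≤ q.totient := Nat.cast_nonneg _
  obtain ⟨Z, w, hZprop, hw, hpf, -⟩ := Cpkg_spec q a T
  set M : ℝ := Cpkg * q.totient * ℒ with hM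
  have hM0 : 0 ≤ M := by positivity
  set Sw : ℝ := ∑ ρ ∈ Z, ‖w ρ‖ with hSw
  have hSw0 : 0 ≤ Sw := Finset.sum_nonneg fun ρ _ ↦ norm_nonneg _
  have hSwM : Sw ≤ M := hw
  have hZfacts : ∀ ρ ∈ Z, ρ.re ≤ σ₁ := by
    intro ρ hρ
    obtain ⟨⟨χ, hχ⟩, hre0, hre1, -⟩ := hZprop ρ hρ
    exact hZ χ ρ hχ (by linarith) hre1
  -- the function and its pointwise bound on the segment
  set F : ℝ → ℂ := fun t ↦ Faux a ((σ' : ℂ) + t * I) with hFdef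
  set Q : ℝ → ℝ := fun t ↦ ∑ ρ ∈ Z, ‖w ρ‖ * (‖(σ' : ℂ) + t * I - ρ‖ ^ 2)⁻¹ with hQdef
  have hpt : ∀ t ∈ seg n, ‖F t‖ ^ 2 ≤ 2 * M ^ 2 + 2 * Sw * Q t := by
    intro t ht
    have hmem := DirichletDisc.mem_closedBall_of_re_mem_Icc (σ := σ') (t := T) (t' := t)
      ⟨hσ'half, hσ'2⟩ (abs_sub_le_of_mem_seg ht)
    have hne1 : ((σ' : ℂ) + t * I) ≠ 1 := by
      intro h; have := congrArg Complex.re h; simp at this; linarith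
    have hL := LFunction_ne_zero_of_lt_re hσ₁ hZ (s := (σ' : ℂ) + t * I) (by simpa using hσ'σ₁) hne1
    have hD : ‖F t - ∑ ρ ∈ Z, w ρ / ((σ' : ℂ) + t * I - ρ)‖ ≤ M := by
      have := hpf _ hmem hne1 hL
      simpa only [hFdef, Faux, hM] using this
    -- `‖F‖ ≤ M + ∑ ‖w‖/‖s-ρ‖`
    have hP : ‖∑ ρ ∈ Z, w ρ / ((σ' : ℂ) + t * I - ρ)‖ ≤ ∑ ρ ∈ Z, ‖w ρ‖ * ‖(σ' : ℂ) + t * I - ρ‖⁻¹ := by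
      refine (norm_sum_le _ _).trans (Finset.sum_le_sum fun ρ _ ↦ ?_)
      rw [norm_div, div_eq_mul_inv]
    have hFle : ‖F t‖ ≤ M + ∑ ρ ∈ Z, ‖w ρ‖ * ‖(σ' : ℂ) + t * I - ρ‖⁻¹ := by
      have := norm_le_insert' (F t) (∑ ρ ∈ Z, w ρ / ((σ' : ℂ) + t * I - ρ))
      -- `‖F‖ ≤ ‖F − P‖ + ‖P‖`
      have h' : ‖F t‖ ≤ ‖F t - ∑ ρ ∈ Z, w ρ / ((σ' : ℂ) + t * I - ρ)‖ +
          ‖∑ ρ ∈ Z, w ρ / ((σ' : ℂ) + t * I - ρ)‖ := norm_le_norm_sub_add _ _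
      linarith
    -- Cauchy–Schwarz: `(∑ ‖w‖/‖s−ρ‖)² ≤ (∑‖w‖)(∑ ‖w‖/‖s−ρ‖²)`
    have hCS : (∑ ρ ∈ Z, ‖w ρ‖ * ‖(σ' : ℂ) + t * I - ρ‖⁻¹) ^ 2 ≤ Sw * Q t := by
      rw [hSw, hQdef]
      refine Finset.sum_sq_le_sum_mul_sum_of_sq_le_mul Z (fun ρ _ ↦ norm_nonneg _)
        (fun ρ _ ↦ by positivity) (fun ρ _ ↦ le_of_eq ?_)
      rw [mul_pow, inv_pow]; ring
    have hS0 : 0 ≤ ∑ ρ ∈ Z, ‖w ρ‖ * ‖(σ' : ℂ) + t * I - ρ‖⁻¹ :=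
      Finset.sum_nonneg fun ρ _ ↦ by positivity
    nlinarith [hFle, hCS, norm_nonneg (F t), sq_nonneg (‖F t‖ - M), sq_nonneg (M - ∑ ρ ∈ Z, ‖w ρ‖ * ‖(σ' : ℂ) + t * I - ρ‖⁻¹)]
  -- continuity and integrability
  have hx : (0 : ℝ) < 1 := one_pos
  have hFcont : Continuous F := by
    rw [hFdef]
    refine continuous_iff_continuousAt.2 fun t ↦ ?_
    have hd : DifferentiableAt ℂ (Faux a) ((σ' : ℂ) + t * I) :=
      differentiableAt_Faux hσ₁ hZ a (by simpa using hσ'σ₁)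
    exact hd.continuousAt.comp (f := fun t : ℝ ↦ ((σ' : ℂ) + t * I)) (by fun_prop)
  have hQcont : Continuous Q := by
    rw [hQdef]
    refine continuous_finsetSum Z fun ρ hρ ↦ continuous_const.mul ((Continuous.inv₀ (by fun_prop) fun t ↦ ?_))
    have hρσ := hZfacts ρ hρ
    have : ((σ' : ℂ) + t * I - ρ) ≠ 0 := by
      intro h; have := congrArg Complex.re h; simp at this; linarith
    positivity
  have hIF : IntegrableOn (fun t ↦ ‖F t‖ ^ 2) (seg n) :=
    ((hFcont.norm.pow 2).integrableOn_Icc).mono_set Ico_subset_Icc_self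
  have hIQ : IntegrableOn (fun t ↦ 2 * M ^ 2 + 2 * Sw * Q t) (seg n) :=
    ((continuous_const.add (continuous_const.mul hQcont)).integrableOn_Icc).mono_set Ico_subset_Icc_self
  refine ⟨hIF, ?_⟩
  have hvol : volume (seg n) < ⊤ := by rw [seg, Real.volume_Ico]; exact ENNReal.ofReal_lt_top
  -- integrate
  have h1 : ∫ t in seg n, ‖F t‖ ^ 2 ≤ ∫ t in seg n, (2 * M ^ 2 + 2 * Sw * Q t) :=
    setIntegral_mono_on hIF hIQ (measurableSet_seg n) hpt
  have hQint : ∫ t in seg n, Q t ≤ Sw * (π / ε) := by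
    have hIq : ∀ ρ ∈ Z, IntegrableOn (fun t : ℝ ↦ ‖w ρ‖ * (‖(σ' : ℂ) + (t : ℂ) * I - ρ‖ ^ 2)⁻¹) (seg n) := by
      intro ρ hρ
      have hρσ := hZfacts ρ hρ
      refine ((continuous_const.mul (Continuous.inv₀ (by fun_prop) fun (t : ℝ) ↦ ?_)).integrableOn_Icc).mono_set
        Ico_subset_Icc_self
      have : ((σ' : ℂ) + (t : ℂ) * I - ρ) ≠ 0 := by
        intro h; have := congrArg Complex.re h; simp at this; linarith
      positivity
    rw [hQdef, integral_finsetSum Z hIq, hSw, Finset.sum_mul]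
    refine Finset.sum_le_sum fun ρ hρ ↦ ?_
    rw [MeasureTheory.integral_const_mul]
    refine mul_le_mul_of_nonneg_left ?_ (norm_nonneg _)
    have hρσ := hZfacts ρ hρ
    have h := setIntegral_seg_inv_norm_sq_le (σ' := σ') (ρ := ρ) (by linarith) n
    refine h.trans ?_
    have hα : ε ≤ σ' - ρ.re := by rw [hσ']; linarith
    exact div_le_div_of_nonneg_left Real.pi_pos.le hε hα
  have h2 : ∫ t in seg n, (2 * M ^ 2 + 2 * Sw * Q t) = 2 * M ^ 2 * (1 / 10) + 2 * Sw * ∫ t in seg n, Q t := by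
    have hI1 : IntegrableOn (fun _ : ℝ ↦ 2 * M ^ 2) (seg n) :=
      (continuous_const.integrableOn_Icc (a := (n : ℝ) / 10 - 1 / 20) (b := (n : ℝ) / 10 + 1 / 20)).mono_set
        Ico_subset_Icc_self
    have hI2 : IntegrableOn (fun t : ℝ ↦ 2 * Sw * Q t) (seg n) :=
      ((continuous_const.mul hQcont).integrableOn_Icc).mono_set Ico_subset_Icc_self
    rw [integral_add hI1 hI2, setIntegral_const, volume_real_seg, MeasureTheory.integral_const_mul]
    simp only [smul_eq_mul]
    ring
  calc ∫ t in seg n, ‖F t‖ ^ 2 ≤ ∫ t in seg n, (2 * M ^ 2 + 2 * Sw * Q t) := h1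
    _ = 2 * M ^ 2 * (1 / 10) + 2 * Sw * ∫ t in seg n, Q t := h2
    _ ≤ 2 * M ^ 2 * (1 / 10) + 2 * Sw * (Sw * (π / ε)) := by gcongr
    _ ≤ 2 * M ^ 2 * (1 / 10) + 2 * M * (M * (π / ε)) := by
        gcongr
    _ ≤ M ^ 2 * ((2 * π + 1) / ε) := by
        have hε' : (2 : ℝ) ≤ ε⁻¹ := by
          rw [le_inv_comm₀ (by norm_num) hε]; linarith
        have k1 : M ^ 2 * (1 / 5) ≤ M ^ 2 * ε⁻¹ := mul_le_mul_of_nonneg_left (by linarith) (sq_nonneg M)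
        have e1 : 2 * M ^ 2 * (1 / 10) + 2 * M * (M * (π / ε)) = M ^ 2 * (1 / 5) + M ^ 2 * ε⁻¹ * (2 * π) := by
          rw [div_eq_mul_inv]; ring
        have e2 : M ^ 2 * ((2 * π + 1) / ε) = M ^ 2 * ε⁻¹ * (2 * π) + M ^ 2 * ε⁻¹ := by
          rw [div_eq_mul_inv]; ring
        rw [e1, e2]
        linarith

/-! ### Mean squares on the whole line against a weight -/

/-- `t ↦ F_{q,a}(σ' + it)` is continuous for `σ' > σ₁` under `ZerosRealPartLE q σ₁`. [folklore] -/
theorem continuous_Faux_line (a : ZMod q) {σ₁ : ℝ} (hσ₁ : 1 / 2 ≤ σ₁) (hZ : ZerosRealPartLE q σ₁)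
    {σ' : ℝ} (hσ' : σ₁ < σ') : Continuous fun t : ℝ ↦ Faux a ((σ' : ℂ) + t * I) := by
  refine continuous_iff_continuousAt.2 fun t ↦ ?_
  have hd : DifferentiableAt ℂ (Faux a) ((σ' : ℂ) + t * I) :=
    differentiableAt_Faux hσ₁ hZ a (by simpa using hσ')
  exact hd.continuousAt.comp (f := fun t : ℝ ↦ ((σ' : ℂ) + t * I)) (by fun_prop)

/-- `ℒ = log q + log(|T| + 4) ≤ (log q + 1) log(|T| + 4)`. [folklore] -/
theorem ell_le_mul_log (q : ℕ) (T : ℝ) :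
    Real.log q + Real.log (|T| + 4) ≤ (Real.log q + 1) * Real.log (|T| + 4) := by
  have h1 : 1 ≤ Real.log (|T| + 4) := by
    rw [Real.le_log_iff_exp_le (by positivity)]
    linarith [Real.exp_one_lt_d9, abs_nonneg T]
  have h2 : 0 ≤ Real.log q := Real.log_natCast_nonneg q
  nlinarith

/-- **Weighted mean square on the line.** Under `ZerosRealPartLE q σ₁` (`σ₁ ≥ 1/2`), `0 < ε`,
`σ₁ + ε < 1`: if `w ≥ 0` is continuous with `w ≤ W_n` on the segment `S_n` and
`∑_n log²(|n/10| + 4) W_n < ∞`, then `t ↦ |F_{q,a}(σ₁ + ε + it)|² w(t)` is integrable and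
`∫ |F_{q,a}|² w ≤ (C φ(q)(log q + 1))² (2π+1) ε⁻¹ ∑_n log²(|n/10| + 4) W_n`.
[cite: MontgomeryVaughan2007, Lemma 12.6 (consequence)] -/
theorem integral_norm_sq_Faux_mul_le (a : ZMod q) {σ₁ : ℝ} (hσ₁ : 1 / 2 ≤ σ₁)
    (hZ : ZerosRealPartLE q σ₁) {ε : ℝ} (hε : 0 < ε) (hσ'1 : σ₁ + ε < 1) {w : ℝ → ℝ}
    (hw : Continuous w) (hw0 : ∀ t, 0 ≤ w t) {Wn : ℤ → ℝ} (hWn0 : ∀ n, 0 ≤ Wn n)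
    (hwW : ∀ n : ℤ, ∀ t ∈ seg n, w t ≤ Wn n)
    (hsum : Summable fun n : ℤ ↦ Real.log (|(n : ℝ) / 10| + 4) ^ 2 * Wn n) :
    Integrable (fun t : ℝ ↦ ‖Faux a ((σ₁ + ε : ℝ) + t * I)‖ ^ 2 * w t) ∧
    ∫ t : ℝ, ‖Faux a ((σ₁ + ε : ℝ) + t * I)‖ ^ 2 * w t ≤
      (Cpkg * q.totient * (Real.log q + 1)) ^ 2 * ((2 * π + 1) / ε) *
        ∑' n : ℤ, Real.log (|(n : ℝ) / 10| + 4) ^ 2 * Wn n := by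
  set σ' : ℝ := σ₁ + ε with hσ'
  have hσ'σ₁ : σ₁ < σ' := by rw [hσ']; linarith
  set G : ℝ → ℝ := fun t ↦ ‖Faux a ((σ' : ℂ) + t * I)‖ ^ 2 * w t with hGdef
  have hG0 : ∀ t, 0 ≤ G t := fun t ↦ mul_nonneg (sq_nonneg _) (hw0 t)
  have hGcont : Continuous G := ((continuous_Faux_line a hσ₁ hZ hσ'σ₁).norm.pow 2).mul hw
  set K : ℝ := (Cpkg * q.totient * (Real.log q + 1)) ^ 2 * ((2 * π + 1) / ε) with hK
  have hK0 : 0 ≤ K := by positivity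
  set b : ℤ → ℝ := fun n ↦ K * (Real.log (|(n : ℝ) / 10| + 4) ^ 2 * Wn n) with hb
  have hbsum : Summable b := hsum.mul_left K
  have hGi : ∀ n : ℤ, IntegrableOn G (seg n) := fun n ↦
    (hGcont.integrableOn_Icc).mono_set Ico_subset_Icc_self
  -- per-segment bound
  have hseg : ∀ n : ℤ, ∫ t in seg n, G t ≤ b n := by
    intro n
    obtain ⟨hIF, hF⟩ := setIntegral_seg_norm_sq_Faux_le a hσ₁ hZ hε hσ'1 n
    have hlog0 : 0 ≤ Real.log q := Real.log_natCast_nonneg q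
    have hL := ell_le_mul_log q ((n : ℝ) / 10)
    have hℒ0 : 0 ≤ Real.log q + Real.log (|(n : ℝ) / 10| + 4) := by
      linarith [DirichletZFR.one_le_ell q ((n : ℝ) / 10)]
    calc ∫ t in seg n, G t ≤ ∫ t in seg n, ‖Faux a ((σ' : ℂ) + t * I)‖ ^ 2 * Wn n := by
          refine setIntegral_mono_on (hGi n) (hIF.mul_const _) (measurableSet_seg n) fun t ht ↦ ?_
          exact mul_le_mul_of_nonneg_left (hwW n t ht) (sq_nonneg _)
      _ = (∫ t in seg n, ‖Faux a ((σ' : ℂ) + t * I)‖ ^ 2) * Wn n := MeasureTheory.integral_mul_const _ _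
      _ ≤ (Cpkg * q.totient * (Real.log q + Real.log (|(n : ℝ) / 10| + 4))) ^ 2 * ((2 * π + 1) / ε) *
            Wn n := mul_le_mul_of_nonneg_right hF (hWn0 n)
      _ ≤ (Cpkg * q.totient * ((Real.log q + 1) * Real.log (|(n : ℝ) / 10| + 4))) ^ 2 *
            ((2 * π + 1) / ε) * Wn n := by
          have hC0 := Cpkg_pos
          have hW0 := hWn0 n
          gcongr
      _ = b n := by rw [hb, hK]; ring
  -- integrability on the line
  have hnorm : ∀ n : ℤ, ∫ t in seg n, ‖G t‖ = ∫ t in seg n, G t := fun n ↦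
    setIntegral_congr_fun (measurableSet_seg n) fun t _ ↦ Real.norm_of_nonneg (hG0 t)
  have hsumnorm : Summable fun n : ℤ ↦ ∫ t in seg n, ‖G t‖ := by
    refine Summable.of_nonneg_of_le (fun n ↦ integral_nonneg fun t ↦ norm_nonneg _) (fun n ↦ ?_) hbsum
    rw [hnorm n]; exact hseg n
  have hInt : Integrable G := by
    have := integrableOn_iUnion_of_summable_integral_norm hGi hsumnorm
    rwa [iUnion_seg, integrableOn_univ] at this
  refine ⟨hInt, ?_⟩
  have hHas : HasSum (fun n : ℤ ↦ ∫ t in seg n, G t) (∫ t, G t) := by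
    have h := hasSum_integral_iUnion measurableSet_seg pairwise_disjoint_seg
      (by rw [iUnion_seg]; exact hInt.integrableOn)
    rwa [iUnion_seg, setIntegral_univ] at h
  rw [← hHas.tsum_eq, show K * ∑' n : ℤ, Real.log (|(n : ℝ) / 10| + 4) ^ 2 * Wn n = ∑' n, b n from
    (tsum_mul_left).symm]
  exact hHas.summable.tsum_le_tsum hseg hbsum

/-- `1/‖σ' + it‖² ≤ 4/(1 + t²)` for `σ' ≥ 1/2`. [folklore] -/
theorem inv_norm_sq_le {σ' : ℝ} (hσ' : 1 / 2 ≤ σ') (t : ℝ) :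
    (‖(σ' : ℂ) + t * I‖ ^ 2)⁻¹ ≤ 4 * (1 + t ^ 2)⁻¹ := by
  rw [Complex.sq_norm, Complex.normSq_add_mul_I]
  rw [← one_div, ← div_eq_mul_inv, div_le_div_iff₀ (by positivity) (by positivity)]
  nlinarith

/-- **`∫ |F_{q,a}(σ₁+ε+it)|² dt/|s|² ≪ φ(q)²(log q + 1)²/ε`.** Under `ZerosRealPartLE q σ₁`
(`σ₁ ≥ 1/2`), `0 < ε`, `σ₁ + ε < 1`: the function is integrable and
`∫ |F_{q,a}(σ'+it)|²/|σ'+it|² dt ≤ 12 S₂ (C φ(q)(log q+1))² (2π+1)/ε`.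
[cite: MontgomeryVaughan2007, Lemma 12.6 (consequence)] -/
theorem integral_norm_sq_Faux_div_le (a : ZMod q) {σ₁ : ℝ} (hσ₁ : 1 / 2 ≤ σ₁)
    (hZ : ZerosRealPartLE q σ₁) {ε : ℝ} (hε : 0 < ε) (hσ'1 : σ₁ + ε < 1) :
    Integrable (fun t : ℝ ↦ ‖Faux a ((σ₁ + ε : ℝ) + t * I)‖ ^ 2 *
      (‖((σ₁ + ε : ℝ) : ℂ) + t * I‖ ^ 2)⁻¹) ∧
    ∫ t : ℝ, ‖Faux a ((σ₁ + ε : ℝ) + t * I)‖ ^ 2 * (‖((σ₁ + ε : ℝ) : ℂ) + t * I‖ ^ 2)⁻¹ ≤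
      (Cpkg * q.totient * (Real.log q + 1)) ^ 2 * ((2 * π + 1) / ε) * (12 * SegmentWeights.S₂) := by
  have hσ'half : 1 / 2 ≤ σ₁ + ε := by linarith
  have hcont : Continuous fun t : ℝ ↦ (‖((σ₁ + ε : ℝ) : ℂ) + t * I‖ ^ 2)⁻¹ := by
    refine Continuous.inv₀ (by fun_prop) fun t ↦ ?_
    have : ((σ₁ + ε : ℝ) : ℂ) + t * I ≠ 0 := by
      intro h; have := congrArg Complex.re h; simp at this; linarith
    positivity
  have h := integral_norm_sq_Faux_mul_le a hσ₁ hZ hε hσ'1 hcont (fun t ↦ by positivity)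
    (Wn := fun n : ℤ ↦ 12 * (1 + ((n : ℝ) / 10) ^ 2)⁻¹) (fun n ↦ by positivity)
    (fun n t ht ↦ (inv_norm_sq_le hσ'half t).trans (by
      have := inv_one_add_sq_le_of_mem_seg ht; linarith)) ?_
  · refine ⟨h.1, h.2.trans (le_of_eq ?_)⟩
    congr 1
    rw [SegmentWeights.S₂, ← tsum_mul_left]
    refine tsum_congr fun n ↦ ?_
    simp only [SegmentWeights.W₂]
    ring
  · have := SegmentWeights.summable_W₂.mul_left 12
    refine this.congr fun n ↦ ?_
    simp only [SegmentWeights.W₂]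
    ring

/-- **`∫ |F_{q,a}(σ₁+ε+it)|² min(1/|s|², θ²) dt ≪ φ(q)²(log q+1)² θ (1 + log(1/θ))²/ε`.** Under
`ZerosRealPartLE q σ₁` (`σ₁ ≥ 1/2`), `0 < ε`, `σ₁ + ε < 1`, `0 < θ ≤ 1`: the function is integrable and
`∫ |F_{q,a}(σ'+it)|² min(1/|σ'+it|², θ²) dt ≤ 10⁶ θ (1 + log(1/θ+1))² (C φ(q)(log q+1))² (2π+1)/ε`.
[cite: MontgomeryVaughan2007, Lemma 12.6 (consequence)] -/
theorem integral_norm_sq_Faux_min_le (a : ZMod q) {σ₁ : ℝ} (hσ₁ : 1 / 2 ≤ σ₁)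
    (hZ : ZerosRealPartLE q σ₁) {ε : ℝ} (hε : 0 < ε) (hσ'1 : σ₁ + ε < 1) {θ : ℝ} (hθ : 0 < θ)
    (hθ1 : θ ≤ 1) :
    Integrable (fun t : ℝ ↦ ‖Faux a ((σ₁ + ε : ℝ) + t * I)‖ ^ 2 *
      min ((‖((σ₁ + ε : ℝ) : ℂ) + t * I‖ ^ 2)⁻¹) (θ ^ 2)) ∧
    ∫ t : ℝ, ‖Faux a ((σ₁ + ε : ℝ) + t * I)‖ ^ 2 * min ((‖((σ₁ + ε : ℝ) : ℂ) + t * I‖ ^ 2)⁻¹) (θ ^ 2) ≤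
      (Cpkg * q.totient * (Real.log q + 1)) ^ 2 * ((2 * π + 1) / ε) *
        (1000000 * θ * (1 + Real.log (1 / θ + 1)) ^ 2) := by
  have hσ'half : 1 / 2 ≤ σ₁ + ε := by linarith
  have hcont : Continuous fun t : ℝ ↦ min ((‖((σ₁ + ε : ℝ) : ℂ) + t * I‖ ^ 2)⁻¹) (θ ^ 2) := by
    refine Continuous.min (Continuous.inv₀ (by fun_prop) fun t ↦ ?_) continuous_const
    have : ((σ₁ + ε : ℝ) : ℂ) + t * I ≠ 0 := by
      intro h; have := congrArg Complex.re h; simp at this; linarith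
    positivity
  have h := integral_norm_sq_Faux_mul_le a hσ₁ hZ hε hσ'1 hcont
    (fun t ↦ le_min (by positivity) (sq_nonneg _))
    (Wn := fun n : ℤ ↦ min (12 * (1 + ((n : ℝ) / 10) ^ 2)⁻¹) (θ ^ 2))
    (fun n ↦ le_min (by positivity) (sq_nonneg _))
    (fun n t ht ↦ min_le_min_right _ ((inv_norm_sq_le hσ'half t).trans (by
      have := inv_one_add_sq_le_of_mem_seg ht; linarith))) (SegmentWeights.summable_W₃ θ)
  exact ⟨h.1, h.2.trans (mul_le_mul_of_nonneg_left (SegmentWeights.tsum_W₃_le hθ hθ1) (by positivity))⟩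

end Literature.NumberTheory.LFunctions.ResidueRiesz

end
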